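import Literature.Combinatorics.Enumerative.PermanentProductForm
import HarnessLib

/-!
# The Balasubramanian–Bax–Franklin–Glynn (BB/FG) formula for the permanent

Topic `Literature/Combinatorics/Enumerative`, companion of `RyserFormula.lean`.  For a square
matrix `A` over a commutative ring, indexed by a finite type `ι` with `N = |ι|`, and sign vectors
`δ ∈ {±1}^ι` (encoded below by the set `s = {k : δ_k = −1}`, `signVec s`):

* `sum_signVec_prod_eq_two_pow_mul_permanent` — the full sign sum
  `Σ_{δ ∈ {±1}^ι} (Π_k δ_k) Π_i Σ_j δ_j a_ij = 2^N per A`;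
* `two_pow_mul_permanent_eq_sum_signVec` — the printed half sum with one sign fixed,
  `2^{N−1} per A = Σ_{δ : δ_{i₀} = 1} (Π_k δ_k) Π_i Σ_j δ_j a_ij` (valid in every commutative ring;
  no division), and `permanent_eq_sum_signVec_div` — literally as printed, over a field with
  `2 ≠ 0`:
  "`Perm(A) = [Σ_δ (Π_{k=1}^N δ_k) Π_{i=1}^N Σ_{j=1}^N δ_j a_ij] / 2^{N−1}` … where `δ₁ = 1` and
  `δᵢ ∈ {−1, 1}` for `2 ≤ i ≤ N`" [cite: WuEtAl2018Tianhe, §2 eq. (2)],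

the "BB/FG algorithm" that, next to Ryser's formula (eq. (1) there), the USTC group benchmarked on
the Tianhe-2 supercomputer to fix the classical side of boson-sampling comparisons ("To test the
upper-bound speed of computing permanents classically") [cite: WuEtAl2018Tianhe, §2]; it has the
same `2^N`-term complexity as Ryser's formula [cite: HangleiterEisert2023, §VII.C.1 ("Alternative
expressions for the permanent with the same number of terms … have been found by Glynn (2010),
using the polarization identity")].

(pub-qadeq lane context, CLAIMS rows E-11…E-15. HONEST FRAMING: instance-level adjudication of
specific advantage claims; no claim about BQP vs BPP or the summit — a classical identity only.)

Proof (polarization / character sum, `sum_powerset_prod_signVec_pow`): expand `Π_i Σ_j δ_j a_ij`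
over the maps `g : ι → ι` (`Finset.prod_univ_sum`); the `g`-term carries `Π_k δ_k^{|g⁻¹(k)|+1}`,
and summing `δ` over the sign vectors supported in `T` gives `Π_{k∈T} (1 + (−1)^{|g⁻¹(k)|+1})`
(`Finset.prod_one_add`), i.e. `2^{|T|}` if every fibre of `g` over `T` is odd and `0` otherwise.
For `T = ι` (full sum) odd fibres force `g` to be a bijection; for `T = ι ∖ {i₀}` (half sum) the
parity count `Σ_k |g⁻¹(k)| = N` shows that the fibre over `i₀` is then odd as well, so again only
bijections survive, and they re-index the permanent (`sum_perm_prod_apply_eq_permanent`).  All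
proved, 0 named facts.  Not here: Gray-code ordering and the numerical-precision comparison that
is the subject of the cited benchmark; Glynn's general invariant-theoretic formulae.

## References

* [WuEtAl2018Tianhe] J. Wu, Y. Liu, B. Zhang, X. Jin, Y. Wang, H. Wang, X. Yang, *A benchmark test
  of boson sampling on Tianhe-2 supercomputer*, National Science Review 5, 715–720 (2018) =
  arXiv:1606.05836, §2 "Results": "Ryser's algorithm is shown in Equation (1) and BB/FG's
  algorithm in Equation (2) … `δ = {δ₁, δ₂, …, δ_N}`, where `δ₁ = 1` and `δᵢ ∈ {−1,1}` for
  `2 ≤ i ≤ N`. (1) `Perm(A) = (−1)^N Σ_{S ⊆ {1,…,N}} (−1)^{|S|} Π_{i=1}^N Σ_{j∈S} a_ij`;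
  (2) `Perm(A) = Σ_δ (Π_{k=1}^N δ_k) Π_{i=1}^N Σ_{j=1}^N δ_j a_ij / 2^{N−1}`" (read via
  `lit read arxiv:1606.05836`, tex chunk p0004 L3–L12).
* [HangleiterEisert2023] D. Hangleiter, J. Eisert, *Computational advantage of quantum random
  sampling*, Rev. Mod. Phys. 95, 035001 (2023) = arXiv:2206.04079, §VII.C.1 (tex chunk p0070).
-/

namespace Literature.Combinatorics.Enumerative

open Finset

variable {ι : Type*} [Fintype ι] [DecidableEq ι] {R : Type*} [CommRing R]

/-- The sign vector `δ ∈ {±1}^ι` encoded by the set `s` of its `−1` coordinates: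
`δ_k = −1` if `k ∈ s`, else `1`. [cite: WuEtAl2018Tianhe, §2 (the vectors `δ`, `δᵢ ∈ {−1,1}`)] -/
def signVec (s : Finset ι) (k : ι) : R := if k ∈ s then -1 else 1

omit [Fintype ι] in
/-- Entries of a sign vector: `δ_k = −1` on `s`, `1` off `s`. [cite: WuEtAl2018Tianhe, §2] -/
theorem signVec_apply (s : Finset ι) (k : ι) :
    (signVec s k : R) = if k ∈ s then -1 else 1 := rfl

omit [Fintype ι] in
/-- Powers of a sign-vector entry: `δ_k^e = (−1)^e` on `s`, `1` off `s`.
[cite: WuEtAl2018Tianhe, §2 eq. (2)] -/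
theorem signVec_pow (s : Finset ι) (k : ι) (e : ℕ) :
    (signVec s k : R) ^ e = if k ∈ s then (-1) ^ e else 1 := by
  unfold signVec
  split_ifs <;> simp

/-- **The character sum over sign vectors** (polarization step of the BB/FG formula): for
exponents `e : ι → ℕ` and sign vectors whose `−1`'s are confined to `T`,
`Σ_{s ⊆ T} Π_k δ(s)_k^{e_k} = Π_{k ∈ T} (1 + (−1)^{e_k})`.
[cite: HangleiterEisert2023, §VII.C.1 ("using the polarization identity")]
[cite: WuEtAl2018Tianhe, §2 eq. (2)] -/
theorem sum_powerset_prod_signVec_pow (T : Finset ι) (e : ι → ℕ) :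
    ∑ s ∈ T.powerset, ∏ k, (signVec s k : R) ^ e k = ∏ k ∈ T, (1 + (-1 : R) ^ e k) := by
  rw [Finset.prod_one_add]
  refine Finset.sum_congr rfl fun s _ => ?_
  simp_rw [signVec_pow]
  rw [← Finset.prod_filter, Finset.filter_mem_eq_inter, Finset.univ_inter]

/-- The character sum over all sign vectors: `Σ_{δ ∈ {±1}^ι} Π_k δ_k^{e_k} = Π_k (1 + (−1)^{e_k})`.
[cite: HangleiterEisert2023, §VII.C.1] [cite: WuEtAl2018Tianhe, §2 eq. (2)] -/
theorem sum_prod_signVec_pow (e : ι → ℕ) :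
    ∑ s : Finset ι, ∏ k, (signVec s k : R) ^ e k = ∏ k, (1 + (-1 : R) ^ e k) := by
  rw [← Finset.powerset_univ, sum_powerset_prod_signVec_pow]

/-- `1 + (−1)^{n+1}` is `2` for odd `n` and `0` for even `n`. [folklore] -/
private theorem one_add_neg_one_pow_succ (n : ℕ) :
    (1 + (-1 : R) ^ (n + 1)) = if Odd n then 2 else 0 := by
  rcases Nat.even_or_odd n with h | h
  · rw [pow_succ, h.neg_one_pow, if_neg (Nat.not_odd_iff_even.mpr h)]; norm_num
  · rw [pow_succ, h.neg_one_pow, if_pos h]; norm_num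

/-- The fibres of a self-map of a finite type are all odd iff the map is a bijection. [folklore] -/
private theorem forall_odd_card_fiber_iff_bijective (g : ι → ι) :
    (∀ k, Odd (univ.filter (fun i => g i = k)).card) ↔ Function.Bijective g := by
  constructor
  · intro h
    rw [← Finite.surjective_iff_bijective]
    intro k
    have hk := h k
    have hpos : 0 < (univ.filter (fun i => g i = k)).card := Nat.pos_of_ne_zero fun h0 => by
      rw [h0] at hk; exact Nat.not_odd_zero hk
    obtain ⟨i, hi⟩ := Finset.card_pos.mp hpos
    exact ⟨i, (Finset.mem_filter.mp hi).2⟩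
  · intro hg k
    have : (univ.filter (fun i => g i = k)).card = 1 := by
      rw [Finset.card_eq_one]
      obtain ⟨i, hi⟩ := hg.2 k
      refine ⟨i, ?_⟩
      ext i'
      simp only [Finset.mem_filter, Finset.mem_univ, true_and, Finset.mem_singleton]
      exact ⟨fun h => hg.1 (h.trans hi.symm), fun h => by rw [h, hi]⟩
    rw [this]
    exact odd_one

/-- Parity count: if the fibres of `g : ι → ι` over all `k ≠ i₀` are odd, so is the fibre over
`i₀` (the fibre sizes sum to `|ι|`, and there are `|ι| − 1` other fibres). [folklore] -/
private theorem odd_card_fiber_of_forall_ne (g : ι → ι) (i₀ : ι)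
    (h : ∀ k, k ≠ i₀ → Odd (univ.filter (fun i => g i = k)).card) :
    Odd (univ.filter (fun i => g i = i₀)).card := by
  have hsum : ∑ k, (univ.filter (fun i => g i = k)).card = Fintype.card ι := by
    rw [← Finset.card_univ]
    exact (Finset.card_eq_sum_card_fiberwise (fun i _ => Finset.mem_univ (g i))).symm
  have hcast := congrArg (fun n : ℕ => (n : ZMod 2)) hsum
  rw [Nat.cast_sum, ← Finset.add_sum_erase _ _ (Finset.mem_univ i₀),
    Finset.sum_congr rfl (fun k hk =>
      (ZMod.natCast_eq_one_iff_odd.mpr (h k (Finset.ne_of_mem_erase hk)))),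
    Finset.sum_const, Finset.card_erase_of_mem (Finset.mem_univ i₀), Finset.card_univ,
    nsmul_eq_mul, mul_one] at hcast
  have hN : ((Fintype.card ι : ℕ) : ZMod 2) = ((Fintype.card ι - 1 : ℕ) : ZMod 2) + 1 := by
    rw [← Nat.cast_add_one, Nat.sub_add_cancel (Fintype.card_pos_iff.mpr ⟨i₀⟩)]
  rw [hN] at hcast
  rw [← ZMod.natCast_eq_one_iff_odd]
  exact add_right_cancel (hcast.trans (add_comm _ _))

/-- With one index `i₀` exempted, "all other fibres odd" is still equivalent to bijectivity.
[folklore] -/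
private theorem forall_erase_odd_iff_bijective (g : ι → ι) (i₀ : ι) :
    (∀ k ∈ univ.erase i₀, Odd (univ.filter (fun i => g i = k)).card) ↔
      Function.Bijective g := by
  rw [← forall_odd_card_fiber_iff_bijective]
  refine ⟨fun h k => ?_, fun h k _ => h k⟩
  by_cases hk : k = i₀
  · subst hk
    exact odd_card_fiber_of_forall_ne g k fun k' hk' =>
      h k' (Finset.mem_erase.mpr ⟨hk', Finset.mem_univ _⟩)
  · exact h k (Finset.mem_erase.mpr ⟨hk, Finset.mem_univ _⟩)

/-- The fibre-parity product evaluates to `2^{|T|}` on bijections and `0` otherwise, whenever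
"all fibres over `T` odd" characterises bijections. [folklore] -/
private theorem prod_ite_odd_eq (g : ι → ι) (T : Finset ι)
    (hT : (∀ k ∈ T, Odd (univ.filter (fun i => g i = k)).card) ↔ Function.Bijective g) :
    ∏ k ∈ T, (if Odd (univ.filter (fun i => g i = k)).card then (2 : R) else 0) =
      if Function.Bijective g then 2 ^ T.card else 0 := by
  rw [Finset.prod_ite_zero, Finset.prod_const]
  by_cases hg : Function.Bijective g
  · rw [if_pos hg, if_pos (hT.mpr hg)]
  · rw [if_neg hg, if_neg (fun h => hg (hT.mp h))]

/-- Expansion of one BB/FG summand over the maps `g : ι → ι`: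
`(Π_k δ_k) Π_i Σ_j δ_j a_ij = Σ_g (Π_i a_{i,g(i)}) Π_k δ_k^{|g⁻¹(k)|+1}`. [folklore] -/
private theorem signVec_summand_expand (A : Matrix ι ι R) (s : Finset ι) :
    (∏ k, (signVec s k : R)) * ∏ i, ∑ j, signVec s j * A i j =
      ∑ g : ι → ι, (∏ i, A i (g i)) *
        ∏ k, (signVec s k : R) ^ ((univ.filter (fun i => g i = k)).card + 1) := by
  rw [Finset.prod_univ_sum, Fintype.piFinset_univ, Finset.mul_sum]
  refine Finset.sum_congr rfl fun g _ => ?_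
  have hfib : ∏ i, (signVec s (g i) : R) =
      ∏ k, (signVec s k : R) ^ (univ.filter (fun i => g i = k)).card := by
    rw [← Finset.prod_fiberwise' univ g (fun k => (signVec s k : R))]
    exact Finset.prod_congr rfl fun k _ => Finset.prod_const _
  rw [Finset.prod_mul_distrib, hfib, ← mul_assoc, ← Finset.prod_mul_distrib]
  simp_rw [pow_succ']
  exact mul_comm _ _

/-- The sign sum supported in `T`, expanded: only the fibre parities of `g` over `T` matter.
[folklore] -/
private theorem sum_powerset_signVec_summand (A : Matrix ι ι R) (T : Finset ι) :
    ∑ s ∈ T.powerset, (∏ k, (signVec s k : R)) * ∏ i, ∑ j, signVec s j * A i j =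
      ∑ g : ι → ι, (∏ i, A i (g i)) *
        ∏ k ∈ T, (if Odd (univ.filter (fun i => g i = k)).card then (2 : R) else 0) := by
  simp_rw [signVec_summand_expand]
  rw [Finset.sum_comm]
  refine Finset.sum_congr rfl fun g _ => ?_
  rw [← Finset.mul_sum, sum_powerset_prod_signVec_pow]
  congr 1
  exact Finset.prod_congr rfl fun k _ => one_add_neg_one_pow_succ _

/-- Only bijections survive: `Σ_g (Π_i a_{i,g(i)}) · c·[g bijective] = c · per A`. [folklore] -/
private theorem sum_prod_apply_mul_ite_bijective (A : Matrix ι ι R) (c : R) :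
    ∑ g : ι → ι, (∏ i, A i (g i)) * (if Function.Bijective g then c else 0) =
      c * A.permanent := by
  simp_rw [mul_ite, mul_zero]
  rw [← Finset.sum_filter, ← Finset.sum_mul, mul_comm c, ← sum_perm_prod_apply_eq_permanent]
  congr 1
  symm
  refine Finset.sum_nbij (fun σ => ⇑σ) ?_ ?_ ?_ ?_
  · intro σ _
    simp only [Finset.mem_filter, Finset.mem_univ, true_and]
    exact σ.bijective
  · exact fun σ _ τ _ h => Equiv.coe_fn_injective h
  · intro g hg
    simp only [Finset.coe_filter, Finset.mem_univ, true_and, Set.mem_setOf_eq] at hg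
    exact ⟨Equiv.ofBijective g hg, by simp, rfl⟩
  · intro σ _
    rfl

/-- **BB/FG (Glynn) formula, full sign sum**: `Σ_{δ ∈ {±1}^ι} (Π_k δ_k) Π_i Σ_j δ_j a_ij = 2^N per A`.
[cite: WuEtAl2018Tianhe, §2 eq. (2)] [cite: HangleiterEisert2023, §VII.C.1] -/
theorem sum_signVec_prod_eq_two_pow_mul_permanent (A : Matrix ι ι R) :
    ∑ s : Finset ι, (∏ k, (signVec s k : R)) * ∏ i, ∑ j, signVec s j * A i j =
      2 ^ Fintype.card ι * A.permanent := by
  rw [← Finset.powerset_univ, sum_powerset_signVec_summand, ← sum_prod_apply_mul_ite_bijective]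
  refine Finset.sum_congr rfl fun g _ => ?_
  congr 1
  rw [prod_ite_odd_eq g univ ⟨fun h => (forall_odd_card_fiber_iff_bijective g).mp
      (fun k => h k (Finset.mem_univ k)),
    fun h k _ => (forall_odd_card_fiber_iff_bijective g).mpr h k⟩, Finset.card_univ]

/-- **BB/FG (Glynn) formula as printed, division-free** (half the sign vectors, the sign at a
chosen index `i₀` fixed to `+1`): `2^{N−1} per A = Σ_{δ : δ_{i₀} = 1} (Π_k δ_k) Π_i Σ_j δ_j a_ij`
in every commutative ring. [cite: WuEtAl2018Tianhe, §2 eq. (2)] -/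
theorem two_pow_mul_permanent_eq_sum_signVec (A : Matrix ι ι R) (i₀ : ι) :
    2 ^ (Fintype.card ι - 1) * A.permanent =
      ∑ s ∈ univ.filter (fun s : Finset ι => i₀ ∉ s),
        (∏ k, (signVec s k : R)) * ∏ i, ∑ j, signVec s j * A i j := by
  have hT : univ.filter (fun s : Finset ι => i₀ ∉ s) = (univ.erase i₀).powerset := by
    ext s
    simp only [Finset.mem_filter, Finset.mem_univ, true_and, Finset.mem_powerset,
      Finset.subset_erase, Finset.subset_univ]
  rw [hT, sum_powerset_signVec_summand, ← sum_prod_apply_mul_ite_bijective]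
  refine Finset.sum_congr rfl fun g _ => ?_
  congr 1
  rw [prod_ite_odd_eq g (univ.erase i₀) (forall_erase_odd_iff_bijective g i₀),
    Finset.card_erase_of_mem (Finset.mem_univ i₀), Finset.card_univ]

/-- **BB/FG (Glynn) formula, literally as printed** (over a field in which `2 ≠ 0`):
"`Perm(A) = [Σ_δ (Π_{k=1}^N δ_k) Π_{i=1}^N Σ_{j=1}^N δ_j a_ij] / 2^{N−1}`, `δ₁ = 1`,
`δᵢ ∈ {−1,1}` for `2 ≤ i ≤ N`" — here `δ_{i₀} = 1` for a chosen index `i₀`.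
[cite: WuEtAl2018Tianhe, §2 eq. (2)] -/
theorem permanent_eq_sum_signVec_div {K : Type*} [Field K] [NeZero (2 : K)]
    (A : Matrix ι ι K) (i₀ : ι) :
    A.permanent =
      (∑ s ∈ univ.filter (fun s : Finset ι => i₀ ∉ s),
        (∏ k, (signVec s k : K)) * ∏ i, ∑ j, signVec s j * A i j) / 2 ^ (Fintype.card ι - 1) := by
  rw [eq_div_iff (pow_ne_zero _ two_ne_zero), mul_comm, two_pow_mul_permanent_eq_sum_signVec]

end Literature.Combinatorics.Enumerative
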